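import Literature.AlgebraicGeometry.AbelianSchemes.PolarizationSpreadStageAmpleLocus
import Literature.AlgebraicGeometry.AbelianSchemes.AbelianSchemeAmpleLocusOpen
import Literature.AlgebraicGeometry.AbelianSchemes.GraphPointLevelZero
import Literature.AlgebraicGeometry.AbelianVarieties.SymmetricDivisorClassPullback
import HarnessLib

/-!
# A rank-one `L` on a stage abelian scheme which is «symmetric ample» at the GENERIC geometric points is of AMPLE CLASS at EVERY geometric point of a
# FINER stage ([GortzWedhorn2023] Thm. 24.46 ∕ [EGAIII1] (4.7.1): the ample locus is open; [EGAIV3] 8.10.5 shape through the locus-to-stage lemma)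

Layer `Literature/AlgebraicGeometry/AbelianSchemes`, namespace `Literature.AlgebraicGeometry.AbelianSchemes.AbelianSchemeOver`.  THEOREMS ONLY
(no definition, no named fact, no instance, no notation, no `sorry`); universe `Scheme.{0}` (that of ★ «AmpleLocusOpen»).  Cell `hodgecm-mathlib`
(D-0151), P6 «MOD programme», L4 DUALS road, organ **(O4-γ)** of the stage Mumford-bundle package (LEAD F0P6-plan (g3) «M-55c»; LA4-plan (g0) DEAL v3;
LA4-p05 (g0)): the binder `hΘ` («at every geometric point the class of an ample divisor», ANY characteristic) of the re-typed socket
`stub_DUALS : DualPairOfAmpleRigidified` (= of ★ (K′) `exists_kOfL_etale_of_isUnit`, ★ KL-STAGE, ★ p848056 O4-ε) for the stage spread `Lₛ` of the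
generic Mumford bundle `L^Δ(λ_E)`.  HC_CM is proved only modulo the printed citations (2 remaining named inputs hLiu418 24832, h413 24833) until rung 0
closes; this file is generic and changes no count.

SETTING (that of ★ `PolarizationSpreadStageAmpleLocus` §2): `K = A_S` a field of characteristic `0`, `P → Spec A` quasi-compact, the stage base
`P ⊗ D(t)` locally Noetherian, `𝒜` an abelian scheme over it, `L` of rank one on `A`.  HYPOTHESIS (`hgen`): at every geometric point `ȳ` of the
GENERIC base `P ⊗ Spec K` (read on the stage through the cone leg `P ◁ π_t`) an ample Cartier divisor `Θ` on `A_ȳ` with `(−1)^*Θ ∼ Θ` and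
`[L|_{A_ȳ}] = [Θ]` in `Ȟ¹(A_ȳ, 𝒪^×)` — the output of ★ B10 `Polarization.exists_isAmple_pullback_fst_detClass_LDelta_eq_cechClass` for `L^Δ(λ)`
(witness `Θ₁ + (−1)^*Θ₁`), transported to the stage spread.

* §1 **`exists_stage_forall_isAmple_detClass_eq_cechClass`** — THEN for some `ρ : s ⟶ t`, at EVERY geometric point `z̄` of `P ⊗ D(s)` (any
  characteristic) there is an ample `Θ′` on the fibre of `𝒜ₛ := 𝒜 ×_{P⊗D(t)} (P ⊗ D(s))` with `[Lₛ|] = [Θ′]`, `Lₛ := (𝒜ₛ → 𝒜)^*L` — the letter's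
  `hΘ` for `(𝒜ₛ, Lₛ)` VERBATIM.  Proof: at a generic geometric point (characteristic `0`, ★ `charZero_of_specMap_comp`) the class hypothesis is a
  module isomorphism `L| ≅ 𝒪(Θ)` (★ `nonempty_iso_iff_detClass_eq`), so ★ `exists_opens_forall_isAmple_iso_lineBundleOfDivisor` (the ample locus
  of `L` is open, witness symmetric ample of characteristic `0`) gives an open of the stage base all of whose field points carry an ample `Θ′` with
  `L| ≅ 𝒪(Θ′)`; ★ `LocApprox.exists_stage_forall_geometricPoint_of_generic` moves to a finer stage; classes transported to the fibres of `𝒜ₛ` along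
  ★ `fibreBaseChangeIso` (the proof of ★ `exists_isAmple_cechClass_fibre_baseChange`, pointwise).
* §2 **`exists_isAmple_symmetric_detClass_eq_cechClass_stage_of_generic`** — bookkeeping for O4-ε's `hwit` on the finer stage: at the geometric
  points of `P ⊗ D(s)` that FACTOR through the generic base (`z̄ = ȳ ≫ (P ◁ π_s)`) the witness of `hgen` transports to an ample SYMMETRIC `Θ′` with
  `[Lₛ|] = [Θ′]` (symmetry along the dominant homomorphism `fibreBaseChangeIso`, ★ `symmetric_pullback_toSchemeHom`).

## References
* [GortzWedhorn2023] U. Görtz, T. Wedhorn, *Algebraic Geometry II* (2023), Thm. 24.46 (p. 397), Cor. 27.285 (p. 723), Rem. 27.185 (p. 674).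
* [EGAIII1] A. Grothendieck, J. Dieudonné, *EGA III₁* (1961), Thm. (4.7.1) (p. 145).
* [EGAIV3] A. Grothendieck, J. Dieudonné, *EGA IV₃* (1966), Thm. 8.10.5; [StacksProject] Tag 01Z3.
* [MumfordFogartyKirwan1994] D. Mumford, J. Fogarty, F. Kirwan, *GIT*, 3rd ed. (1994), Ch. 6 §2 Def. 6.2–6.3 (p. 120), Prop. 6.10 (p. 121).
* [MumfordAV1970] D. Mumford, *Abelian Varieties* (1970), §16–§17, §8 (ii)–(iv) (pp. 74–75).
-/

set_option autoImplicit false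

noncomputable section

-- `TopCat.Presheaf`/`Scheme.Modules` and pull-back bookkeeping (as in ★ `AbelianSchemes/AbelianSchemeAmpleLocusOpen`).
set_option backward.isDefEq.respectTransparency false

open CategoryTheory CategoryTheory.Limits AlgebraicGeometry MonoidalCategory CartesianMonoidalCategory
open scoped MonObj

namespace Literature.AlgebraicGeometry.AbelianSchemes

namespace AbelianSchemeOver

open Literature.AlgebraicGeometry.Motives Literature.AlgebraicGeometry.AbelianVarieties Literature.AlgebraicGeometry.Modules
open Literature.AlgebraicGeometry.Limits Literature.AlgebraicGeometry.Limits.LocApprox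

section Stage

variable {A : Type} [CommRing A] {S : Submonoid A} (K : Type) [Field K] [CharZero K] [Algebra A K] [IsLocalization S K]
  {P : SchemeOver A} [QuasiCompact P.hom] {t : Idx S} [IsLocallyNoetherian (P ⊗ (baseDiagram S).obj t).left]
  (𝒜 : AbelianSchemeOver (P ⊗ (baseDiagram S).obj t).left) (L : 𝒜.X.left.Modules) (hL : HasRank L 1)

/-- Class ⇒ isomorphism at a geometric point: `[L|_{A_x̄}] = [Θ]` ⇒ `L|_{A_x̄} ≅ 𝒪(Θ)` (rank-one modules on the integral fibre, ★
`nonempty_iso_iff_detClass_eq`). [cite: MumfordFogartyKirwan1994, Ch. 6 §2 Definition 6.2 (p. 120)] -/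
private theorem nonempty_iso_lineBundleOfDivisor_of_cechClass {T : Scheme.{0}} (ℬ : AbelianSchemeOver T) (M : ℬ.X.left.Modules)
    (hM : HasRank M 1) {Ω : Type} [Field Ω] (xb : Spec (.of Ω) ⟶ T) (Θ : CartierDivisor (ℬ.fibre xb).toAbelianVariety.X.left)
    (hcl : CechPic.pullback (X := (ℬ.fibre xb).toAbelianVariety.X.left) (pullback.fst ℬ.X.hom xb)
      (detClass (HasRank.isFiniteLocallyFree' hM)) = Θ.cechClass) :
    Nonempty ((Scheme.Modules.pullback (pullback.fst ℬ.X.hom xb)).obj M ≅ ℬ.lineBundleOfDivisor xb Θ) := by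
  let B := (ℬ.fibre xb).toAbelianVariety
  haveI : IsIntegral B.X.left :=
    haveI := B.geometricallyIntegral
    GeometricallyIntegral.isIntegral_of_subsingleton B.X.hom
  haveI : IsIntegral (pullback ℬ.X.hom xb) := ‹IsIntegral B.X.left›
  have hMf : IsFiniteLocallyFree ((Scheme.Modules.pullback (pullback.fst ℬ.X.hom xb)).obj M) :=
    (HasRank.isFiniteLocallyFree' hM).pullback _
  refine (nonempty_iso_iff_detClass_eq (hasRank_pullback _ hM) Θ.toUnitCocycle.hasRank_lineBundle hMf
    Θ.toUnitCocycle.isFiniteLocallyFree_lineBundle).2 ?_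
  rw [detClass_lineBundle_toUnitCocycle, ← hcl, detClass_pullback _ (HasRank.isFiniteLocallyFree' hM)]

/-- Isomorphism ⇒ class at a geometric point: `L|_{A_x̄} ≅ 𝒪(Θ)` ⇒ `[L|_{A_x̄}] = [Θ]`. [cite: MumfordFogartyKirwan1994, Ch. 6 §2 Definition 6.2 (p. 120)] -/
private theorem cechClass_of_nonempty_iso_lineBundleOfDivisor {T : Scheme.{0}} (ℬ : AbelianSchemeOver T) (M : ℬ.X.left.Modules)
    (hM : HasRank M 1) {Ω : Type} [Field Ω] (xb : Spec (.of Ω) ⟶ T) (Θ : CartierDivisor (ℬ.fibre xb).toAbelianVariety.X.left)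
    (e : Nonempty ((Scheme.Modules.pullback (pullback.fst ℬ.X.hom xb)).obj M ≅ ℬ.lineBundleOfDivisor xb Θ)) :
    CechPic.pullback (X := (ℬ.fibre xb).toAbelianVariety.X.left) (pullback.fst ℬ.X.hom xb)
      (detClass (HasRank.isFiniteLocallyFree' hM)) = Θ.cechClass := by
  let B := (ℬ.fibre xb).toAbelianVariety
  haveI : IsIntegral B.X.left :=
    haveI := B.geometricallyIntegral
    GeometricallyIntegral.isIntegral_of_subsingleton B.X.hom
  haveI : IsIntegral (pullback ℬ.X.hom xb) := ‹IsIntegral B.X.left›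
  have hMf : IsFiniteLocallyFree ((Scheme.Modules.pullback (pullback.fst ℬ.X.hom xb)).obj M) :=
    (HasRank.isFiniteLocallyFree' hM).pullback _
  have h := (nonempty_iso_iff_detClass_eq (hasRank_pullback _ hM) Θ.toUnitCocycle.hasRank_lineBundle hMf
    Θ.toUnitCocycle.isFiniteLocallyFree_lineBundle).1 e
  rw [detClass_lineBundle_toUnitCocycle, detClass_pullback _ (HasRank.isFiniteLocallyFree' hM)] at h
  exact h

/-- **Ample fibre class at ONE geometric point survives base change of the abelian scheme** (pointwise form of ★
`exists_isAmple_cechClass_fibre_baseChange`): `[L|_{A_{s′ ≫ p}}] = [Θ]` with `Θ` ample ⇒ `[(A_p → A)^*L|_{(A_p)_{s′}}] = [e^*Θ]` with `e^*Θ`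
ample, `e : (A_p)_{s′} ≅ A_{s′ ≫ p}` (★ `fibreBaseChangeIso`); if moreover `(−1)^*Θ ∼ Θ` then `(−1)^*(e^*Θ) ∼ e^*Θ` (★ `symmetric_pullback_toSchemeHom`).
[cite: MumfordFogartyKirwan1994, Ch. 6 §2 Definition 6.2 (p. 120)] [cite: GortzWedhorn2020, Section (4.7) (pp. 107–108)]
[cite: MumfordAV1970, §8 (ii)–(iv) (pp. 74–75)] -/
theorem exists_isAmple_cechClass_fibre_baseChange_at {T T' : Scheme.{0}} (ℬ : AbelianSchemeOver T) {M : ℬ.left.Modules} (hM : HasRank M 1)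
    (p : T' ⟶ T) (hM' : HasRank ((Scheme.Modules.pullback (pullback.fst ℬ.X.hom p)).obj M) 1)
    {Ω : Type} [Field Ω] [IsAlgClosed Ω] (s' : Spec (.of Ω) ⟶ T')
    (Θ : CartierDivisor (ℬ.fibre (s' ≫ p)).toAbelianVariety.X.left) (hamp : Θ.IsAmple)
    (hc : CechPic.pullback (X := (ℬ.fibre (s' ≫ p)).toAbelianVariety.X.left) (pullback.fst ℬ.X.hom (s' ≫ p))
      (detClass (HasRank.isFiniteLocallyFree' hM)) = Θ.cechClass) :
    ∃ Θ' : CartierDivisor ((ℬ.baseChange p).fibre s').toAbelianVariety.X.left, Θ'.IsAmple ∧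
      CechPic.pullback (X := ((ℬ.baseChange p).fibre s').toAbelianVariety.X.left) (pullback.fst (ℬ.baseChange p).X.hom s')
        (detClass (HasRank.isFiniteLocallyFree' hM')) = Θ'.cechClass ∧
      ((Θ.pullback (AbelianVariety.Hom.toSchemeHom (-𝟙 (ℬ.fibre (s' ≫ p)).toAbelianVariety))).LinEquiv Θ →
        (Θ'.pullback (AbelianVariety.Hom.toSchemeHom (-𝟙 ((ℬ.baseChange p).fibre s').toAbelianVariety))).LinEquiv Θ') := by
  let e := ℬ.fibreBaseChangeIso p s'
  haveI : IsIso (AbelianVariety.Hom.toSchemeHom e.hom) :=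
    ⟨AbelianVariety.Hom.toSchemeHom e.inv, by
      change AbelianVariety.Hom.toSchemeHom (e.hom ≫ e.inv) = _; rw [e.hom_inv_id]; rfl, by
      change AbelianVariety.Hom.toSchemeHom (e.inv ≫ e.hom) = _; rw [e.inv_hom_id]; rfl⟩
  haveI := AbelianVariety.isDominant_toSchemeHom_iso_hom e
  refine ⟨Θ.pullback (AbelianVariety.Hom.toSchemeHom e.hom), hamp.pullback _, ?_, fun hsym => ?_⟩
  · rw [CartierDivisor.cechClass_pullback, ← hc, detClass_pullback _ (HasRank.isFiniteLocallyFree' hM), ← CechPic.pullback_comp,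
      ← CechPic.pullback_comp, ℬ.fibreBaseChangeIso_hom_toSchemeHom_fst p s']
    rfl
  · rw [← AbelianVarieties.symmetric_iff_pullback_neg_id_linEquiv] at hsym ⊢
    exact AbelianVarieties.symmetric_pullback_toSchemeHom e.hom hsym

include hL in
/-- **(O4-γ) AN `L` WHICH IS «SYMMETRIC AMPLE» AT THE GENERIC GEOMETRIC POINTS IS OF AMPLE CLASS AT EVERY GEOMETRIC POINT OF A FINER STAGE.**
`K = A_S` a field of characteristic `0`, `P → Spec A` quasi-compact, `P ⊗ D(t)` locally Noetherian, `𝒜` an abelian scheme over it, `L` rank one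
on `A`; (`hgen`) at every geometric point `ȳ` of the generic base an ample `Θ` with `(−1)^*Θ ∼ Θ` and `[L|_{A_ȳ}] = [Θ]`.  THEN for some `ρ : s ⟶ t`,
at EVERY geometric point `z̄` of `P ⊗ D(s)` there is an ample `Θ′` on the fibre of `𝒜ₛ = 𝒜 ×_{P⊗D(t)} (P ⊗ D(s))` with `[(𝒜ₛ → 𝒜)^*L|] = [Θ′]` — the
`hΘ` binder of `DualPairOfAmpleRigidified` ∕ ★ (K′) ∕ ★ KL-STAGE for `(𝒜ₛ, Lₛ)`.  The ample locus of `L` is open around every generic geometric point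
(★ `exists_opens_forall_isAmple_iso_lineBundleOfDivisor`, char-`0` symmetric witness; [GortzWedhorn2023] Thm. 24.46), and a condition holding on a
neighbourhood of every generic geometric point holds on a finer stage (★ `exists_stage_forall_geometricPoint_of_generic`).
[cite: GortzWedhorn2023, Thm. 24.46 (p. 397) and Cor. 27.285 (p. 723)] [cite: EGAIII1, Thm. (4.7.1) p. 145] [cite: StacksProject, Tag 01Z3] -/
theorem exists_stage_forall_isAmple_detClass_eq_cechClass
    (hgen : ∀ (Ω : Type) [Field Ω] [IsAlgClosed Ω] (yb : Spec (.of Ω) ⟶ (P ⊗ specOver A K).left),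
      ∃ Θ : CartierDivisor (𝒜.fibre (yb ≫ (P ◁ leg S K t).left)).toAbelianVariety.X.left, Θ.IsAmple ∧
        (Θ.pullback (AbelianVariety.Hom.toSchemeHom (-𝟙 (𝒜.fibre (yb ≫ (P ◁ leg S K t).left)).toAbelianVariety))).LinEquiv Θ ∧
        CechPic.pullback (X := (𝒜.fibre (yb ≫ (P ◁ leg S K t).left)).toAbelianVariety.X.left)
          (pullback.fst 𝒜.X.hom (yb ≫ (P ◁ leg S K t).left)) (detClass (HasRank.isFiniteLocallyFree' hL)) = Θ.cechClass) :
    ∃ (s : Idx S) (ρ : s ⟶ t), ∀ (Ω : Type) [Field Ω] [IsAlgClosed Ω] (zb : Spec (.of Ω) ⟶ (P ⊗ (baseDiagram S).obj s).left),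
      ∃ Θ' : CartierDivisor ((𝒜.baseChange (stageOver S P ρ).hom).fibre zb).toAbelianVariety.X.left, Θ'.IsAmple ∧
        CechPic.pullback (X := ((𝒜.baseChange (stageOver S P ρ).hom).fibre zb).toAbelianVariety.X.left)
          (pullback.fst (𝒜.baseChange (stageOver S P ρ).hom).X.hom zb)
          (detClass (HasRank.isFiniteLocallyFree'
            (hasRank_pullback (pullback.fst 𝒜.X.hom (stageOver S P ρ).hom) hL))) = Θ'.cechClass := by
  -- the condition «ample class» moves from a neighbourhood of the generic geometric points to a finer stage
  obtain ⟨s, ρ, hs⟩ := exists_stage_forall_geometricPoint_of_generic K P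
    (fun Ω _ _ zb => ∃ Θ' : CartierDivisor (𝒜.fibre zb).toAbelianVariety.X.left, Θ'.IsAmple ∧
      CechPic.pullback (X := (𝒜.fibre zb).toAbelianVariety.X.left) (pullback.fst 𝒜.X.hom zb)
        (detClass (HasRank.isFiniteLocallyFree' hL)) = Θ'.cechClass)
    (fun Ω _ _ yb => by
      -- the generic geometric point has characteristic `0`
      haveI : CharZero Ω := charZero_of_specMap_comp (pullback.snd P.hom (specOver A K).hom) yb
      obtain ⟨Θ, hΘ, hsym, hcl⟩ := hgen Ω yb
      have e := nonempty_iso_lineBundleOfDivisor_of_cechClass 𝒜 L hL (yb ≫ (P ◁ leg S K t).left) Θ hcl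
      obtain ⟨U, hxU, hU⟩ := 𝒜.exists_opens_forall_isAmple_iso_lineBundleOfDivisor L hL
        ((yb ≫ (P ◁ leg S K t).left) (IsLocalRing.closedPoint Ω)) (yb ≫ (P ◁ leg S K t).left) ⟨_, rfl⟩ hΘ hsym e
      refine ⟨U, ?_, fun Ω' _ _ zb hzb => ?_⟩
      · rintro _ ⟨q, rfl⟩
        rw [Subsingleton.elim q (IsLocalRing.closedPoint Ω)]
        exact hxU
      · obtain ⟨Θ₂, hΘ₂, e₂⟩ := hU Ω' zb hzb
        exact ⟨Θ₂, hΘ₂, cechClass_of_nonempty_iso_lineBundleOfDivisor 𝒜 L hL zb Θ₂ e₂⟩)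
  refine ⟨s, ρ, fun Ω _ _ zb => ?_⟩
  obtain ⟨Θ', hΘ', hc⟩ := hs Ω zb
  obtain ⟨Θ'', hΘ'', hc'', -⟩ := exists_isAmple_cechClass_fibre_baseChange_at 𝒜 hL (stageOver S P ρ).hom
    (hasRank_pullback (pullback.fst 𝒜.X.hom (stageOver S P ρ).hom) hL) zb Θ' hΘ' hc
  exact ⟨Θ'', hΘ'', hc''⟩

omit [CharZero K] [QuasiCompact P.hom] [IsLocallyNoetherian (P ⊗ (baseDiagram S).obj t).left] in
include hL in
/-- **Bookkeeping for O4-ε on the finer stage**: at a geometric point `z̄ = ȳ ≫ (P ◁ π_s)` of `P ⊗ D(s)` factoring through the GENERIC base, the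
symmetric ample class witness of `hgen` transports to the fibre of `𝒜ₛ`: an ample `Θ′` with `(−1)^*Θ′ ∼ Θ′` and `[(𝒜ₛ → 𝒜)^*L|] = [Θ′]` (the `hwit` of ★
p848056 `exists_opens_finite_image_compl_forall_affineOpen_isProjective_of_cechClass` at such points; `(P ◁ π_s) ≫ (P ◁ D(ρ)) = P ◁ π_t`, ★
`whiskerLeft_leg_left_comp_whiskerLeft_map_left`). [cite: MumfordAV1970, §8 (ii)–(iv) (pp. 74–75)] [cite: GortzWedhorn2023, Rem. 27.185 (p. 674)] -/
theorem exists_isAmple_symmetric_detClass_eq_cechClass_stage_of_generic {s : Idx S} (ρ : s ⟶ t)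
    (hgen : ∀ (Ω : Type) [Field Ω] [IsAlgClosed Ω] (yb : Spec (.of Ω) ⟶ (P ⊗ specOver A K).left),
      ∃ Θ : CartierDivisor (𝒜.fibre (yb ≫ (P ◁ leg S K t).left)).toAbelianVariety.X.left, Θ.IsAmple ∧
        (Θ.pullback (AbelianVariety.Hom.toSchemeHom (-𝟙 (𝒜.fibre (yb ≫ (P ◁ leg S K t).left)).toAbelianVariety))).LinEquiv Θ ∧
        CechPic.pullback (X := (𝒜.fibre (yb ≫ (P ◁ leg S K t).left)).toAbelianVariety.X.left)
          (pullback.fst 𝒜.X.hom (yb ≫ (P ◁ leg S K t).left)) (detClass (HasRank.isFiniteLocallyFree' hL)) = Θ.cechClass)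
    (Ω : Type) [Field Ω] [IsAlgClosed Ω] (yb : Spec (.of Ω) ⟶ (P ⊗ specOver A K).left) :
    ∃ Θ' : CartierDivisor ((𝒜.baseChange (stageOver S P ρ).hom).fibre (yb ≫ (P ◁ leg S K s).left)).toAbelianVariety.X.left, Θ'.IsAmple ∧
      (Θ'.pullback (AbelianVariety.Hom.toSchemeHom
        (-𝟙 ((𝒜.baseChange (stageOver S P ρ).hom).fibre (yb ≫ (P ◁ leg S K s).left)).toAbelianVariety))).LinEquiv Θ' ∧
      CechPic.pullback (X := ((𝒜.baseChange (stageOver S P ρ).hom).fibre (yb ≫ (P ◁ leg S K s).left)).toAbelianVariety.X.left)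
        (pullback.fst (𝒜.baseChange (stageOver S P ρ).hom).X.hom (yb ≫ (P ◁ leg S K s).left))
        (detClass (HasRank.isFiniteLocallyFree'
          (hasRank_pullback (pullback.fst 𝒜.X.hom (stageOver S P ρ).hom) hL))) = Θ'.cechClass := by
  -- `(ȳ ≫ P ◁ π_s) ≫ (P ◁ D(ρ)) = ȳ ≫ P ◁ π_t`
  have hcomp : (yb ≫ (P ◁ leg S K s).left) ≫ (stageOver S P ρ).hom = yb ≫ (P ◁ leg S K t).left := by
    rw [Category.assoc]
    exact congrArg (yb ≫ ·) (whiskerLeft_leg_left_comp_whiskerLeft_map_left S K P ρ)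
  obtain ⟨Θ, hΘ, hsym, hcl⟩ := hgen Ω yb
  -- move the witness along the equality of points, then along `fibreBaseChangeIso`
  have key : ∀ (w : Spec (.of Ω) ⟶ (P ⊗ (baseDiagram S).obj t).left) (hw : w = yb ≫ (P ◁ leg S K t).left),
      ∃ Θ₀ : CartierDivisor (𝒜.fibre w).toAbelianVariety.X.left, Θ₀.IsAmple ∧
        (Θ₀.pullback (AbelianVariety.Hom.toSchemeHom (-𝟙 (𝒜.fibre w).toAbelianVariety))).LinEquiv Θ₀ ∧
        CechPic.pullback (X := (𝒜.fibre w).toAbelianVariety.X.left) (pullback.fst 𝒜.X.hom w)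
          (detClass (HasRank.isFiniteLocallyFree' hL)) = Θ₀.cechClass := by
    rintro w rfl
    exact ⟨Θ, hΘ, hsym, hcl⟩
  obtain ⟨Θ₀, hΘ₀, hsym₀, hcl₀⟩ := key _ hcomp
  obtain ⟨Θ', hΘ', hc', hsym'⟩ := exists_isAmple_cechClass_fibre_baseChange_at 𝒜 hL (stageOver S P ρ).hom
    (hasRank_pullback (pullback.fst 𝒜.X.hom (stageOver S P ρ).hom) hL) (yb ≫ (P ◁ leg S K s).left) Θ₀ hΘ₀ hcl₀
  exact ⟨Θ', hΘ', hsym' hsym₀, hc'⟩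

end Stage

end AbelianSchemeOver

end Literature.AlgebraicGeometry.AbelianSchemes

end
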